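import Summits.ABC.IUTFork.BrobergSlotResidueExact
import Summits.ABC.IUTFork.LDHGenuineUnionPrintIsmDegTwo
import Summits.ABC.IUTFork.LDHGenuinePerImagePrintIsmBroberg
import HarnessLib

/-!
# The fork at [IUTchIII] Corollary 3.12, L-DH level, READING (U) over PRINT's (Ind2) at Broberg's QUADRATIC point `λ ∈ ℚ(√7)`:
# the union inequality HOLDS for every genuine Θ-volume datum and every print-dominated `H`, at `l = 7` and `l = 11` — INHABITED TRUE rows,
# at data where the per-image reading (P) over the same (Ind2) FAILS (row «C:UNION-PRINT-ISM-BROBERG», RULING (α), C LEAD abc-iut-plan g12)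

Record-only PROOF file (D-0012; 0 def / 0 `Prop` fact / 0 instance / 0 notation) of the abc-iut cell (seat abc-iut-c312-d1, gen 12); sequel of
`LDHGenuineUnionPrintIsmDegTwo.lean` (p525460: (U) over print's (Ind2) ⟺ `κ_l·log q^{∤{2,l}}(λ) − slotResidue(T) ≤ ((l+5)/4)·log π`, any `d_mod`) and
`BrobergSlotResidueExact.lean` (`Broberg.slotResidue_eq`: `slotResidue(T) = (11·log 3 + 4·log 47)/l · (1/ℓ⋆)Σ_{i<ℓ⋆}(i+1)²(½ − (½)^{i+2})` EXACTLY).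
TAKES NO SIDE on [IUTchIII] Cor. 3.12.

* `Broberg.shallow_sub_slotResidue_seven` / `_eleven` — the deciding inequality at `l = 7` (`ℓ⋆ = 3`: `κ₇·(13·log 3 + 4·log 47) − (13/48)·(11·log 3 + 4·log 47)
  = (143/336)·log 3 − (1/28)·log 47 ≤ 3·log π`) and at `l = 11` (`ℓ⋆ = 5`: `(2991/3520)·log 3 − (76/3520)·log 47 ≤ 4·log π`) — only `log 3 ≤ 2`, `log 47 ≥ 0`,
  `log π > 1` are used (abc-iut-C-cert-2 `Broberg.logQAvoid_pair_of_ne`);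
* **`Broberg.union_printInd2_seven`** / **`…_eleven`** — for EVERY genuine Θ-volume datum `T` at `(Broberg.point, 7)` resp. `(…, 11)` and EVERY
  print-dominated `H`: the union inequality (U) over print's (Ind2) HOLDS;
* **`Broberg.nonempty_and_union_printInd2_and_not_perImage_seven`** / **`…_eleven`** — AND the datum types are INHABITED (abc-iut-W-row-2
  `Broberg.nonempty_thetaVolumeDatumAt_seven/_eleven`, unconditional) AND at the same data the per-image inequality (P) over print's (Ind2) FAILS
  (this lineage's gen 11 `Broberg.not_perImage_printInd2`, p511550): the two readings of [IUTchIII] Cor. 3.12 over ONE typing of (Ind2) DISAGREE at an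
  exhibited genuine datum.

CENSUS WORDS (numbers about OUR typings; the C LEAD decides). «At Broberg's quadratic point (`d_mod = 2`; poles `𝔭₃ : 2`, `𝔭₃' : 24`, `𝔭₄₇ : 8`, both
`3` and `47` split in `ℚ(√7)`) the (Ind1) capsule permutations alone — symmetrising over collections that mix a shallow and a deep conjugate place —
recover `slotResidue(T) = (11·log 3 + 4·log 47)/l · (1/ℓ⋆)Σ_{i<ℓ⋆}(i+1)²(½ − 2^{−(i+2)})` (`≈ 7.44` at `l = 7`, `≈ 12.64` at `l = 11`) of Θ-side, which exceeds
`gap − arch` (`≈ 4.34`, `≈ 8.91`): reading (U) over PRINT's (Ind2) HOLDS ∀T ∀H at `l = 7, 11` (types inhabited), while reading (P) over the same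
(Ind2) FAILS there (p511550) and both readings fail at every rational (d_mod = 1) tabulated row with `log q^{∤2l} ≥ 24`. First inhabited TRUE row of
the (U)-over-print-(Ind2) reading at `d_mod ≥ 2`; first exhibited datum where OUR two typed readings of Cor. 3.12 part ways under one (Ind2).»

HONEST SCOPE: statements about OUR typing of print's (Ind2) (`Real.ismIsm`, unit homotheties) and of (Ind1) (Dupuy–Hilado's capsule permutations)
inside the cell's L-DH Corollary; true-AS-TYPED, refuted-AS-TYPED ≠ in print; (Ind1)'s strip part (abc-iut-c312-1 R17/R18), (Ind3), the log-link and [IUTchIII]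
Cor. 3.12 itself untouched; NO height bound follows (a known abc triple); records UNCHANGED (K p460293 · p460539 · p464272 · γ p462946; M twins).
[cite: Mochizuki2012, IUTchIII Cor. 3.12 p. 173–174; Thm. 3.11 (i) (Ind1)(Ind2) p. 154] [cite: Mochizuki2012, IUTchIV Thm. 1.10 Step (v) p. 27–28, Step (viii)
p. 30; Cor. 2.2 (ii) proof (P5)–(P7) p. 46] [cite: DupuyHilado2025, §4.7, §4.11, §4.12] [claim: Mochizuki2012, status: disputed] for every IUT quotation.
-/

noncomputable section

open scoped Classical NumberField

open NumberField IsDedekindDomain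

namespace Summit.ABC.IUTFork.Broberg

open Sqrt7 Literature.IUT.LogVolume Literature.IUT.LogVolume.Cor22 Literature.IUT.HodgeTheaters Literature.NumberTheory.NumberFields
  Literature.NumberTheory.DiophantineGeometry.GenEll Thm311.Real

/-! ## 1. The deciding inequalities at `l = 7` and `l = 11` -/

/-- `log 3 ≤ 2`, `0 ≤ log 47`, `1 < log π` — the only transcendental input. [folklore] -/
private theorem log_bounds : Real.log 3 ≤ 2 ∧ 0 ≤ Real.log 47 ∧ 1 < Real.log Real.pi := by
  refine ⟨?_, Real.log_nonneg (by norm_num), ?_⟩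
  · have := Real.log_le_sub_one_of_pos (show (0 : ℝ) < 3 by norm_num); linarith
  · rw [Real.lt_log_iff_exp_lt Real.pi_pos]
    have := Real.exp_one_lt_d9
    linarith [Real.pi_gt_three]

/-- **`l = 7`**: `κ₇·log q^{∤{2,7}}(λ) − slotResidue(T) ≤ 3·log π` at every genuine datum `T` of `(Broberg.point, 7)` (`ℓ⋆ = 3`; LHS `=
(143/336)·log 3 − (1/28)·log 47 ≈ 0.33`). [cite: Mochizuki2012, IUTchIV Thm. 1.10 Step (viii) p. 30] [claim: Mochizuki2012, status: disputed] -/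
theorem shallow_sub_slotResidue_seven (T : ThetaVolumeDatumAt point 7) :
    (letI := T.instFieldF; letI := T.instNumberFieldF; letI := T.instAlgebraF; letI := T.instFieldK
     letI := T.instNumberFieldK; letI := T.instAlgebraK; letI := T.instFieldFbar; letI := T.instAlgebraFbar
     letI := T.instAlgebraKFbar; letI := T.instIsElliptic
     ((((7 : ℕ) : ℝ) + 1) / 24 - 1 / (2 * ((7 : ℕ) : ℝ))) * logQAvoid point {2, 7} - T.I.X.slotResidue T.I.supportPrimes ≤
       (((7 : ℕ) : ℝ) + 5) / 4 * Real.log Real.pi) := by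
  letI := T.instFieldF; letI := T.instNumberFieldF; letI := T.instAlgebraF; letI := T.instFieldK
  letI := T.instNumberFieldK; letI := T.instAlgebraK; letI := T.instFieldFbar; letI := T.instAlgebraFbar
  letI := T.instAlgebraKFbar; letI := T.instIsElliptic
  have hl : T.I.X.l = 7 := (PointDict.X_S_eq T).2.2
  have hls : T.I.X.lstar = 3 := by
    show (T.I.X.l - 1) / 2 = 3
    rw [hl]
  have hsum : ∑ i : Fin T.I.X.lstar, (((i : ℕ) + 1 : ℝ) ^ 2) * (1 / 2 - (1 / 2 : ℝ) ^ ((i : ℕ) + 2)) =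
      ∑ i ∈ Finset.range T.I.X.lstar, (((i : ℝ) + 1) ^ 2) * (1 / 2 - (1 / 2 : ℝ) ^ (i + 2)) :=
    Fin.sum_univ_eq_sum_range (fun i : ℕ => (((i : ℝ) + 1) ^ 2) * (1 / 2 - (1 / 2 : ℝ) ^ (i + 2))) T.I.X.lstar
  rw [logQAvoid_pair_of_ne (by norm_num) (by norm_num) (by norm_num),
    slotResidue_eq (by norm_num) (by norm_num) (by norm_num) T, hsum, hls]
  simp only [Finset.sum_range_succ, Finset.sum_range_zero]
  obtain ⟨h3, h47, hπ⟩ := log_bounds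
  norm_num
  nlinarith

/-- **`l = 11`**: `κ₁₁·log q^{∤{2,11}}(λ) − slotResidue(T) ≤ 4·log π` at every genuine datum `T` of `(Broberg.point, 11)` (`ℓ⋆ = 5`; LHS `=
(2991/3520)·log 3 − (76/3520)·log 47 ≈ 0.85`). [cite: Mochizuki2012, IUTchIV Thm. 1.10 Step (viii) p. 30] [claim: Mochizuki2012, status: disputed] -/
theorem shallow_sub_slotResidue_eleven (T : ThetaVolumeDatumAt point 11) :
    (letI := T.instFieldF; letI := T.instNumberFieldF; letI := T.instAlgebraF; letI := T.instFieldK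
     letI := T.instNumberFieldK; letI := T.instAlgebraK; letI := T.instFieldFbar; letI := T.instAlgebraFbar
     letI := T.instAlgebraKFbar; letI := T.instIsElliptic
     ((((11 : ℕ) : ℝ) + 1) / 24 - 1 / (2 * ((11 : ℕ) : ℝ))) * logQAvoid point {2, 11} - T.I.X.slotResidue T.I.supportPrimes ≤
       (((11 : ℕ) : ℝ) + 5) / 4 * Real.log Real.pi) := by
  letI := T.instFieldF; letI := T.instNumberFieldF; letI := T.instAlgebraF; letI := T.instFieldK
  letI := T.instNumberFieldK; letI := T.instAlgebraK; letI := T.instFieldFbar; letI := T.instAlgebraFbar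
  letI := T.instAlgebraKFbar; letI := T.instIsElliptic
  have hl : T.I.X.l = 11 := (PointDict.X_S_eq T).2.2
  have hls : T.I.X.lstar = 5 := by
    show (T.I.X.l - 1) / 2 = 5
    rw [hl]
  have hsum : ∑ i : Fin T.I.X.lstar, (((i : ℕ) + 1 : ℝ) ^ 2) * (1 / 2 - (1 / 2 : ℝ) ^ ((i : ℕ) + 2)) =
      ∑ i ∈ Finset.range T.I.X.lstar, (((i : ℝ) + 1) ^ 2) * (1 / 2 - (1 / 2 : ℝ) ^ (i + 2)) :=
    Fin.sum_univ_eq_sum_range (fun i : ℕ => (((i : ℝ) + 1) ^ 2) * (1 / 2 - (1 / 2 : ℝ) ^ (i + 2))) T.I.X.lstar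
  rw [logQAvoid_pair_of_ne (by norm_num) (by norm_num) (by norm_num),
    slotResidue_eq (by norm_num) (by norm_num) (by norm_num) T, hsum, hls]
  simp only [Finset.sum_range_succ, Finset.sum_range_zero]
  obtain ⟨h3, h47, hπ⟩ := log_bounds
  norm_num
  nlinarith

/-! ## 2. Reading (U) over PRINT's (Ind2) HOLDS at Broberg's point, `l = 7` and `l = 11` -/

/-- **`l = 7`: for every genuine Θ-volume datum `T` at `(Broberg.point, 7)` and every print-dominated `H`, the union inequality (U) with Θ-side over
print's (Ind2) HOLDS** (this lineage's criterion `union_printInd2_iff_shallow_sub_slotResidue`, p525460, `.mpr`). [cite: Mochizuki2012, IUTchIII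
Cor. 3.12 p. 174; Thm. 3.11 (i) p. 154] [claim: Mochizuki2012, status: disputed] -/
theorem union_printInd2_seven (T : ThetaVolumeDatumAt point 7) :
    letI := T.instFieldF; letI := T.instNumberFieldF; letI := T.instFieldK; letI := T.instNumberFieldK
    letI := T.instAlgebraK; letI := T.instIsElliptic
    ∀ (H : (p : ℕ) → (hp : p.Prime) → (j : ℕ) →
        (e : Fin (j + 1) → placesOver (Literature.IUT.HodgeTheaters.fieldOfModuli T.E) p) →
        haveI : Fact p.Prime := ⟨hp⟩
        Subgroup (PacketAlgebra p (fun b => (T.I.σ.localFields p).k (e b)) ≃ₗ[ℚ_[p]]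
          PacketAlgebra p (fun b => (T.I.σ.localFields p).k (e b)))),
      (∀ (p : ℕ) (hp : p.Prime), haveI : Fact p.Prime := ⟨hp⟩
        ∀ j e, ∀ g ∈ H p hp j e,
          ∃ ψ : ∀ b : Fin (j + 1), Carrier (.inr (T.I.σ.lift (e b).1) : Thm311.Real.Place T.K) ≃ₗ[ℚ]
              Carrier (.inr (T.I.σ.lift (e b).1) : Thm311.Real.Place T.K),
            (∀ b, ψ b ∈ ismIsm (analyticLogv T.K) (T.I.σ.lift (e b).1)) ∧
            ∀ x : ∀ b, (T.I.σ.localFields p).k (e b),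
              (g : PacketAlgebra p (fun b => (T.I.σ.localFields p).k (e b)) ≃ₗ[ℚ_[p]]
                  PacketAlgebra p (fun b => (T.I.σ.localFields p).k (e b))) (PiTensorProduct.tprod ℚ_[p] x) =
                PiTensorProduct.tprod ℚ_[p] (fun b =>
                  RescaledCompletion.of T.K p (T.I.σ.lift (e b).1) (T.I.σ.natCast_mem_lift (e b))
                    (ψ b ((RescaledCompletion.of T.K p (T.I.σ.lift (e b).1) (T.I.σ.natCast_mem_lift (e b))).symm (x b))))) →
      T.negAbsLogQ ≤
          (∑ p ∈ T.I.supportPrimes,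
            if hp : p.Prime then
              (haveI : Fact p.Prime := ⟨hp⟩
               (T.I.packetAt p hp).lnνLp T.I.lstar (fun j e =>
                 packetHull p (fun b => (T.I.σ.localFields p).k (e b))
                   (⋃ g : H p hp j e, (g : PacketAlgebra p (fun b => (T.I.σ.localFields p).k (e b)) ≃ₗ[ℚ_[p]]
                       PacketAlgebra p (fun b => (T.I.σ.localFields p).k (e b))) ''
                     ⋃ τ : Equiv.Perm (Fin (j + 1)), (T.I.packetAt p hp).perm τ e ''
                       (T.I.packetAt p hp).pilotRegion (T.I.tΘ p hp) j (e ∘ τ))))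
            else 0) + ThetaVolumeInput.archLogTheta 7 :=
  fun H hH => (T.union_printInd2_iff_shallow_sub_slotResidue point_inU H hH).mpr (shallow_sub_slotResidue_seven T)

/-- **`l = 11`: for every genuine Θ-volume datum `T` at `(Broberg.point, 11)` and every print-dominated `H`, the union inequality (U) over print's
(Ind2) HOLDS.** [cite: Mochizuki2012, IUTchIII Cor. 3.12 p. 174; Thm. 3.11 (i) p. 154] [claim: Mochizuki2012, status: disputed] -/
theorem union_printInd2_eleven (T : ThetaVolumeDatumAt point 11) :
    letI := T.instFieldF; letI := T.instNumberFieldF; letI := T.instFieldK; letI := T.instNumberFieldK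
    letI := T.instAlgebraK; letI := T.instIsElliptic
    ∀ (H : (p : ℕ) → (hp : p.Prime) → (j : ℕ) →
        (e : Fin (j + 1) → placesOver (Literature.IUT.HodgeTheaters.fieldOfModuli T.E) p) →
        haveI : Fact p.Prime := ⟨hp⟩
        Subgroup (PacketAlgebra p (fun b => (T.I.σ.localFields p).k (e b)) ≃ₗ[ℚ_[p]]
          PacketAlgebra p (fun b => (T.I.σ.localFields p).k (e b)))),
      (∀ (p : ℕ) (hp : p.Prime), haveI : Fact p.Prime := ⟨hp⟩
        ∀ j e, ∀ g ∈ H p hp j e,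
          ∃ ψ : ∀ b : Fin (j + 1), Carrier (.inr (T.I.σ.lift (e b).1) : Thm311.Real.Place T.K) ≃ₗ[ℚ]
              Carrier (.inr (T.I.σ.lift (e b).1) : Thm311.Real.Place T.K),
            (∀ b, ψ b ∈ ismIsm (analyticLogv T.K) (T.I.σ.lift (e b).1)) ∧
            ∀ x : ∀ b, (T.I.σ.localFields p).k (e b),
              (g : PacketAlgebra p (fun b => (T.I.σ.localFields p).k (e b)) ≃ₗ[ℚ_[p]]
                  PacketAlgebra p (fun b => (T.I.σ.localFields p).k (e b))) (PiTensorProduct.tprod ℚ_[p] x) =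
                PiTensorProduct.tprod ℚ_[p] (fun b =>
                  RescaledCompletion.of T.K p (T.I.σ.lift (e b).1) (T.I.σ.natCast_mem_lift (e b))
                    (ψ b ((RescaledCompletion.of T.K p (T.I.σ.lift (e b).1) (T.I.σ.natCast_mem_lift (e b))).symm (x b))))) →
      T.negAbsLogQ ≤
          (∑ p ∈ T.I.supportPrimes,
            if hp : p.Prime then
              (haveI : Fact p.Prime := ⟨hp⟩
               (T.I.packetAt p hp).lnνLp T.I.lstar (fun j e =>
                 packetHull p (fun b => (T.I.σ.localFields p).k (e b))
                   (⋃ g : H p hp j e, (g : PacketAlgebra p (fun b => (T.I.σ.localFields p).k (e b)) ≃ₗ[ℚ_[p]]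
                       PacketAlgebra p (fun b => (T.I.σ.localFields p).k (e b))) ''
                     ⋃ τ : Equiv.Perm (Fin (j + 1)), (T.I.packetAt p hp).perm τ e ''
                       (T.I.packetAt p hp).pilotRegion (T.I.tΘ p hp) j (e ∘ τ))))
            else 0) + ThetaVolumeInput.archLogTheta 11 :=
  fun H hH => (T.union_printInd2_iff_shallow_sub_slotResidue point_inU H hH).mpr (shallow_sub_slotResidue_eleven T)

/-! ## 3. INHABITED, and the two readings DISAGREE there -/

/-- **WITNESS `l = 7`: the datum type at `(Broberg.point, 7)` is INHABITED, and at EVERY datum, for EVERY print-dominated `H`, the union inequality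
(U) over print's (Ind2) HOLDS while the per-image inequality (P) over the same (Ind2) FAILS** (NV: abc-iut-W-row-2
`Broberg.nonempty_thetaVolumeDatumAt_seven`; (P): gen 11 `Broberg.not_perImage_printInd2`, p511550). [cite: Mochizuki2012, IUTchIII Cor. 3.12 p. 173–174]
[cite: Mochizuki2012, IUTchIV Cor. 2.2 (ii) proof (P6)(P7) p. 46] [claim: Mochizuki2012, status: disputed] -/
theorem nonempty_and_union_printInd2_and_not_perImage_seven :
    Nonempty (ThetaVolumeDatumAt point 7) ∧
    ∀ T : ThetaVolumeDatumAt point 7,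
    letI := T.instFieldF; letI := T.instNumberFieldF; letI := T.instFieldK; letI := T.instNumberFieldK
    letI := T.instAlgebraK; letI := T.instIsElliptic
    ∀ (H : (p : ℕ) → (hp : p.Prime) → (j : ℕ) →
        (e : Fin (j + 1) → placesOver (Literature.IUT.HodgeTheaters.fieldOfModuli T.E) p) →
        haveI : Fact p.Prime := ⟨hp⟩
        Subgroup (PacketAlgebra p (fun b => (T.I.σ.localFields p).k (e b)) ≃ₗ[ℚ_[p]]
          PacketAlgebra p (fun b => (T.I.σ.localFields p).k (e b)))),
      (∀ (p : ℕ) (hp : p.Prime), haveI : Fact p.Prime := ⟨hp⟩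
        ∀ j e, ∀ g ∈ H p hp j e,
          ∃ ψ : ∀ b : Fin (j + 1), Carrier (.inr (T.I.σ.lift (e b).1) : Thm311.Real.Place T.K) ≃ₗ[ℚ]
              Carrier (.inr (T.I.σ.lift (e b).1) : Thm311.Real.Place T.K),
            (∀ b, ψ b ∈ ismIsm (analyticLogv T.K) (T.I.σ.lift (e b).1)) ∧
            ∀ x : ∀ b, (T.I.σ.localFields p).k (e b),
              (g : PacketAlgebra p (fun b => (T.I.σ.localFields p).k (e b)) ≃ₗ[ℚ_[p]]
                  PacketAlgebra p (fun b => (T.I.σ.localFields p).k (e b))) (PiTensorProduct.tprod ℚ_[p] x) =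
                PiTensorProduct.tprod ℚ_[p] (fun b =>
                  RescaledCompletion.of T.K p (T.I.σ.lift (e b).1) (T.I.σ.natCast_mem_lift (e b))
                    (ψ b ((RescaledCompletion.of T.K p (T.I.σ.lift (e b).1) (T.I.σ.natCast_mem_lift (e b))).symm (x b))))) →
      (T.negAbsLogQ ≤
          (∑ p ∈ T.I.supportPrimes,
            if hp : p.Prime then
              (haveI : Fact p.Prime := ⟨hp⟩
               (T.I.packetAt p hp).lnνLp T.I.lstar (fun j e =>
                 packetHull p (fun b => (T.I.σ.localFields p).k (e b))
                   (⋃ g : H p hp j e, (g : PacketAlgebra p (fun b => (T.I.σ.localFields p).k (e b)) ≃ₗ[ℚ_[p]]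
                       PacketAlgebra p (fun b => (T.I.σ.localFields p).k (e b))) ''
                     ⋃ τ : Equiv.Perm (Fin (j + 1)), (T.I.packetAt p hp).perm τ e ''
                       (T.I.packetAt p hp).pilotRegion (T.I.tΘ p hp) j (e ∘ τ))))
            else 0) + ThetaVolumeInput.archLogTheta 7) ∧
      ¬ (T.negAbsLogQ ≤
          (∑ p ∈ T.I.supportPrimes,
            if hp : p.Prime then
              (haveI : Fact p.Prime := ⟨hp⟩
               (T.I.packetAt p hp).lnνLp T.I.lstar (fun j e =>
                 packetHull p (fun b => (T.I.σ.localFields p).k (e b))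
                   (⋃ g : H p hp j e, (g : PacketAlgebra p (fun b => (T.I.σ.localFields p).k (e b)) ≃ₗ[ℚ_[p]]
                       PacketAlgebra p (fun b => (T.I.σ.localFields p).k (e b))) ''
                     (T.I.packetAt p hp).pilotRegion (T.I.tΘ p hp) j e)))
            else 0) + ThetaVolumeInput.archLogTheta 7) :=
  ⟨nonempty_thetaVolumeDatumAt_seven, fun T H hH =>
    ⟨union_printInd2_seven T H hH, not_perImage_printInd2 (by norm_num) (by norm_num) (by norm_num) T H hH⟩⟩

/-- **WITNESS `l = 11`**: the same at `(Broberg.point, 11)` (NV: `Broberg.nonempty_thetaVolumeDatumAt_eleven`). [cite: Mochizuki2012, IUTchIII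
Cor. 3.12 p. 173–174] [cite: Mochizuki2012, IUTchIV Cor. 2.2 (ii) proof (P6)(P7) p. 46] [claim: Mochizuki2012, status: disputed] -/
theorem nonempty_and_union_printInd2_and_not_perImage_eleven :
    Nonempty (ThetaVolumeDatumAt point 11) ∧
    ∀ T : ThetaVolumeDatumAt point 11,
    letI := T.instFieldF; letI := T.instNumberFieldF; letI := T.instFieldK; letI := T.instNumberFieldK
    letI := T.instAlgebraK; letI := T.instIsElliptic
    ∀ (H : (p : ℕ) → (hp : p.Prime) → (j : ℕ) →
        (e : Fin (j + 1) → placesOver (Literature.IUT.HodgeTheaters.fieldOfModuli T.E) p) →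
        haveI : Fact p.Prime := ⟨hp⟩
        Subgroup (PacketAlgebra p (fun b => (T.I.σ.localFields p).k (e b)) ≃ₗ[ℚ_[p]]
          PacketAlgebra p (fun b => (T.I.σ.localFields p).k (e b)))),
      (∀ (p : ℕ) (hp : p.Prime), haveI : Fact p.Prime := ⟨hp⟩
        ∀ j e, ∀ g ∈ H p hp j e,
          ∃ ψ : ∀ b : Fin (j + 1), Carrier (.inr (T.I.σ.lift (e b).1) : Thm311.Real.Place T.K) ≃ₗ[ℚ]
              Carrier (.inr (T.I.σ.lift (e b).1) : Thm311.Real.Place T.K),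
            (∀ b, ψ b ∈ ismIsm (analyticLogv T.K) (T.I.σ.lift (e b).1)) ∧
            ∀ x : ∀ b, (T.I.σ.localFields p).k (e b),
              (g : PacketAlgebra p (fun b => (T.I.σ.localFields p).k (e b)) ≃ₗ[ℚ_[p]]
                  PacketAlgebra p (fun b => (T.I.σ.localFields p).k (e b))) (PiTensorProduct.tprod ℚ_[p] x) =
                PiTensorProduct.tprod ℚ_[p] (fun b =>
                  RescaledCompletion.of T.K p (T.I.σ.lift (e b).1) (T.I.σ.natCast_mem_lift (e b))
                    (ψ b ((RescaledCompletion.of T.K p (T.I.σ.lift (e b).1) (T.I.σ.natCast_mem_lift (e b))).symm (x b))))) →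
      (T.negAbsLogQ ≤
          (∑ p ∈ T.I.supportPrimes,
            if hp : p.Prime then
              (haveI : Fact p.Prime := ⟨hp⟩
               (T.I.packetAt p hp).lnνLp T.I.lstar (fun j e =>
                 packetHull p (fun b => (T.I.σ.localFields p).k (e b))
                   (⋃ g : H p hp j e, (g : PacketAlgebra p (fun b => (T.I.σ.localFields p).k (e b)) ≃ₗ[ℚ_[p]]
                       PacketAlgebra p (fun b => (T.I.σ.localFields p).k (e b))) ''
                     ⋃ τ : Equiv.Perm (Fin (j + 1)), (T.I.packetAt p hp).perm τ e ''
                       (T.I.packetAt p hp).pilotRegion (T.I.tΘ p hp) j (e ∘ τ))))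
            else 0) + ThetaVolumeInput.archLogTheta 11) ∧
      ¬ (T.negAbsLogQ ≤
          (∑ p ∈ T.I.supportPrimes,
            if hp : p.Prime then
              (haveI : Fact p.Prime := ⟨hp⟩
               (T.I.packetAt p hp).lnνLp T.I.lstar (fun j e =>
                 packetHull p (fun b => (T.I.σ.localFields p).k (e b))
                   (⋃ g : H p hp j e, (g : PacketAlgebra p (fun b => (T.I.σ.localFields p).k (e b)) ≃ₗ[ℚ_[p]]
                       PacketAlgebra p (fun b => (T.I.σ.localFields p).k (e b))) ''
                     (T.I.packetAt p hp).pilotRegion (T.I.tΘ p hp) j e)))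
            else 0) + ThetaVolumeInput.archLogTheta 11) :=
  ⟨nonempty_thetaVolumeDatumAt_eleven, fun T H hH =>
    ⟨union_printInd2_eleven T H hH, not_perImage_printInd2 (by norm_num) (by norm_num) (by norm_num) T H hH⟩⟩

end Summit.ABC.IUTFork.Broberg

end
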